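import Literature.NumberTheory.QuadraticFields.KroneckerSplitting
import Literature.NumberTheory.QuadraticFields.DiscriminantOfSqrt
import Literature.NumberTheory.EllipticCurves.ShuZhai2021.GeneralizedBirchLemma
import Mathlib.FieldTheory.KummerPolynomial
import HarnessLib

/-!
# Reading the symbols off "`q` is inert in `ℚ(√D)`" and "every `ℓ ∣ n` splits in `ℚ(√D)`"

Topic `NumberTheory/QuadraticFields`, namespace `Literature.NumberTheory.QuadraticFields.Quadratic`
(continuing `KroneckerSplitting.lean`, `DiscriminantOfSqrt.lean`). Theorems only (no definition, no named fact).

The tree states splitting conditions of the literature on quadratic twists IDEAL-THEORETICALLY: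
`CaiLiZhai2019.IsInertIn q D` / `ShuZhai2021.IsInertInSqrt q Δ` ("`q𝓞_F` is a prime ideal in every quadratic
number field `F ∋ √D`"), `EllipticCurves.SatisfiesHeegnerHypothesis n F` ("every `p ∣ n` has two primes of `𝓞_F`
above it") and `ShuZhai2021.AllPrimesSplitInSqrt n D` ("`D` is a square, or every quadratic `F ∋ √D` satisfies the
Heegner hypothesis for `n`"). A `2`-descent needs them as LEGENDRE SYMBOLS. By the decomposition law
(Marcus, *Number Fields*, Ch. 3, Thm. 25; tree `ncard_primesOver_eq_two_iff_legendreSym`,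
`ncard_primesOver_two_eq_two_iff`) and the discriminant of `ℚ(√D)` (Ch. 2, Thm. 1; tree
`discr_eq_of_sq_eq_intCast`, `discr_eq_four_mul_of_sq_eq_intCast`):

* `exists_numberField_sq_eq_of_not_isSquare` — a model of `ℚ(√D)` for `D ∈ ℤ` not a square (`ℚ[X]/(X² - D)`);
* `not_isPrime_span_of_ncard_primesOver_eq_two` — a SPLIT prime is not inert: if two primes of `𝓞 K` lie over
  `p` then `p𝓞_K` is not a prime ideal (a nonzero prime of the Dedekind domain `𝓞 K` is maximal);
* `exists_squarefree_mul_sq_eq` — `D = d₀ f²`, `d₀` squarefree; `legendreSym_discr_eq_of_sq_eq_intCast` — for a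
  quadratic `K ∋ θ`, `θ² = D`, and an odd prime `q ∤ D`: `(d_K/q) = (D/q)` (both are `(d₀/q)`);
* **`legendreSym_eq_neg_one_of_isInertIn`** — `q` odd, `q ∤ D`, `q` inert in `ℚ(√D)` ⟹ `(D/q) = -1`
  (otherwise `(D/q) = 1`, `q` splits in `ℚ(√D)` — or in `ℚ(√(1-q))` when `D` is a square — and is not inert);
* **`not_dvd_and_legendreSym_eq_one_of_allPrimesSplitInSqrt`** — `D` squarefree and not a square, every
  `ℓ ∣ n` split in `ℚ(√D)`, `ℓ ∣ n` an odd prime ⟹ `ℓ ∤ D` and `(D/ℓ) = 1`;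
  **`emod_eight_eq_one_of_allPrimesSplitInSqrt`** — and if `2 ∣ n` then `D ≡ 1 (mod 8)`.

Cell `bsd-f1-sign2` (LEAD gk2-p1): the Legendre-symbol content of the hypotheses `IsFullAdmissible` /
`FullBaseSetting` of LINE 49 «full_vertex» (Shu–Zhai 2021, Def. 1.1 / Thm. 1.4), toward stub D0≤2.

## References

* [Marcus2018] D. A. Marcus, *Number Fields*, 2nd ed., Universitext (2018), Ch. 2 Thm. 1, Ch. 3 Thm. 25.
* [Cox2013] D. A. Cox, *Primes of the form `x² + ny²`*, 2nd ed. (2013), Prop. 5.16, Cor. 5.17.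
* [ShuZhai2021] J. Shu, S. Zhai, *Generalized Birch lemma and the 2-part of the Birch and Swinnerton-Dyer
  conjecture for certain elliptic curves*, arXiv:2102.11808, Def. 1.1 and §1 ("every prime `ℓ ∣ N` splits").
-/

noncomputable section

open scoped Classical

open Polynomial Ideal NumberField Module
open Literature.NumberTheory.EllipticCurves

namespace Literature.NumberTheory.QuadraticFields.Quadratic

/-! ### A model of `ℚ(√D)` -/

/-- An integer which is a square in `ℚ` is a square in `ℤ` (`ℤ` is integrally closed). [folklore] -/
private theorem isSquare_int_of_sq_eq_ratCast {D : ℤ} {r : ℚ} (hr : r ^ 2 = (D : ℚ)) : IsSquare D := by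
  have hint : IsIntegral ℤ r := by
    refine ⟨X ^ 2 - C D, by monicity!, ?_⟩
    simp only [eval₂_sub, eval₂_X_pow, eval₂_C]
    rw [hr]
    simp
  obtain ⟨n, hn⟩ := IsIntegrallyClosed.isIntegral_iff.mp hint
  rw [← hn, eq_intCast] at hr
  exact ⟨n, by rw [← sq]; exact_mod_cast hr.symm⟩

/-- **A model of `ℚ(√D)`**: for an integer `D` that is not a square there is a quadratic number field
`K = ℚ[X]/(X² − D)` with an element `θ`, `θ² = D`. [cite: Marcus2018, Ch. 2 Thm. 1] -/
theorem exists_numberField_sq_eq_of_not_isSquare {D : ℤ} (hD : ¬ IsSquare D) :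
    ∃ (K : Type) (_ : Field K) (_ : NumberField K), finrank ℚ K = 2 ∧ ∃ θ : K, θ ^ 2 = (D : K) := by
  have hirr : Irreducible (X ^ 2 - C (D : ℚ) : ℚ[X]) :=
    X_pow_sub_C_irreducible_of_prime Nat.prime_two fun b hb => hD (isSquare_int_of_sq_eq_ratCast hb)
  haveI : Fact (Irreducible (X ^ 2 - C (D : ℚ) : ℚ[X])) := ⟨hirr⟩
  have hmonic : (X ^ 2 - C (D : ℚ) : ℚ[X]).Monic := monic_X_pow_sub_C _ two_ne_zero
  haveI : Module.Finite ℚ (AdjoinRoot (X ^ 2 - C (D : ℚ) : ℚ[X])) := hmonic.finite_adjoinRoot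
  haveI : CharZero (AdjoinRoot (X ^ 2 - C (D : ℚ) : ℚ[X])) :=
    charZero_of_injective_algebraMap (algebraMap ℚ (AdjoinRoot (X ^ 2 - C (D : ℚ) : ℚ[X]))).injective
  haveI : NumberField (AdjoinRoot (X ^ 2 - C (D : ℚ) : ℚ[X])) := NumberField.mk
  refine ⟨AdjoinRoot (X ^ 2 - C (D : ℚ) : ℚ[X]), inferInstance, inferInstance, ?_, AdjoinRoot.root _, ?_⟩
  · rw [(AdjoinRoot.powerBasis hmonic.ne_zero).finrank, AdjoinRoot.powerBasis_dim, natDegree_X_pow_sub_C]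
  · have h := AdjoinRoot.eval₂_root (X ^ 2 - C (D : ℚ) : ℚ[X])
    rw [eval₂_sub, eval₂_X_pow, eval₂_C, sub_eq_zero] at h
    exact h.trans (map_intCast _ D)

/-! ### A split prime is not inert -/

section Split

variable {K : Type*} [Field K] [NumberField K]

/-- **A split prime is not inert**: if two primes of `𝓞 K` lie over the rational prime `p`, then `p𝓞_K` is
not a prime ideal (every prime over `p` contains `p𝓞_K`, which if prime is maximal, forcing both to equal it).
[cite: Marcus2018, Ch. 3 Thm. 25 (and Ch. 3, "e f g = n")] -/
theorem not_isPrime_span_of_ncard_primesOver_eq_two {p : ℕ} (hp : p.Prime)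
    (h : ((span {(p : ℤ)}).primesOver (𝓞 K)).ncard = 2) : ¬ (span {((p : ℤ) : 𝓞 K)}).IsPrime := by
  intro hI
  obtain ⟨P₁, P₂, hne, heq⟩ := Set.ncard_eq_two.mp h
  have hI0 : span {((p : ℤ) : 𝓞 K)} ≠ ⊥ := by
    rw [Ne, span_singleton_eq_bot]
    exact_mod_cast hp.ne_zero
  have hmax : (span {((p : ℤ) : 𝓞 K)}).IsMaximal := hI.isMaximal hI0
  have key : ∀ P ∈ (span {(p : ℤ)}).primesOver (𝓞 K), P = span {((p : ℤ) : 𝓞 K)} := by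
    rintro P ⟨hPprime, hPover⟩
    have hle : span {((p : ℤ) : 𝓞 K)} ≤ P := by
      rw [span_le, Set.singleton_subset_iff, SetLike.mem_coe]
      have := (P.mem_of_liesOver (span {(p : ℤ)}) (p : ℤ)).mp (mem_span_singleton_self _)
      simpa using this
    exact (hmax.eq_of_le hPprime.ne_top hle).symm
  have h1 : P₁ ∈ (span {(p : ℤ)}).primesOver (𝓞 K) := by rw [heq]; exact Set.mem_insert _ _
  have h2 : P₂ ∈ (span {(p : ℤ)}).primesOver (𝓞 K) := by rw [heq]; exact Set.mem_insert_of_mem _ rfl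
  exact hne ((key P₁ h1).trans (key P₂ h2).symm)

end Split

/-! ### Squarefree kernel and the Legendre symbol of `d_K` -/

/-- **Squarefree kernel**: every non-zero integer is `d₀ f²` with `d₀` squarefree and `f ≠ 0` (the normal form
`K = ℚ(√N)`, `N` squarefree, of a quadratic field). [cite: Marcus2018, Ch. 2 Thm. 1] [cite: Cox2013, §5.B (5.12)] -/
theorem exists_squarefree_mul_sq_eq {D : ℤ} (hD : D ≠ 0) :
    ∃ d₀ f : ℤ, Squarefree d₀ ∧ f ≠ 0 ∧ D = d₀ * f ^ 2 := by
  obtain ⟨a, b, hab, ha⟩ := Nat.sq_mul_squarefree D.natAbs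
  have hb0 : b ≠ 0 := by
    rintro rfl
    simp only [ne_eq, OfNat.ofNat_ne_zero, not_false_eq_true, zero_pow, zero_mul] at hab
    exact hD (Int.natAbs_eq_zero.mp hab.symm)
  refine ⟨D.sign * a, b, ?_, by exact_mod_cast hb0, ?_⟩
  · refine Int.squarefree_natAbs.mp ?_
    have hs : (D.sign).natAbs = 1 := Int.natAbs_sign_of_ne_zero hD
    rw [Int.natAbs_mul, hs, one_mul, Int.natAbs_natCast]
    exact ha
  · calc D = D.sign * (D.natAbs : ℤ) := (Int.sign_mul_natAbs D).symm
      _ = D.sign * a * (b : ℤ) ^ 2 := by rw [← hab]; push_cast; ring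

variable {K : Type} [Field K] [NumberField K]

/-- `d % 4` for a squarefree integer is `1`, `2` or `3`. [folklore] -/
private theorem emod_four_of_squarefree {d : ℤ} (hd : Squarefree d) : d % 4 = 1 ∨ (d % 4 = 2 ∨ d % 4 = 3) := by
  have h4 : ¬ (4 : ℤ) ∣ d := fun h => by
    have := hd 2 (by rw [show (2 : ℤ) * 2 = 4 by norm_num]; exact h)
    exact absurd (Int.isUnit_iff.mp this) (by decide)
  omega

/-- **`d_K ∈ {d₀, 4 d₀}` read on Legendre symbols**: for a quadratic field `K ∋ θ` with `θ² = d₀` squarefree,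
`d₀ ≠ 1`, and an odd prime `q`: `(d_K/q) = (d₀/q)`. [cite: Marcus2018, Ch. 2 Thm. 1] -/
theorem legendreSym_discr_eq_of_sq_eq_squarefree (h2 : finrank ℚ K = 2) {θ : K} {d₀ : ℤ} (hsq : θ ^ 2 = (d₀ : K))
    (hsf : Squarefree d₀) (hd1 : d₀ ≠ 1) {q : ℕ} [Fact q.Prime] (hq2 : q ≠ 2) :
    legendreSym q (NumberField.discr K) = legendreSym q d₀ := by
  rcases emod_four_of_squarefree hsf with h1 | h23
  · rw [discr_eq_of_sq_eq_intCast h2 hsq h1 hsf hd1]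
  · rw [discr_eq_four_mul_of_sq_eq_intCast h2 hsq h23 hsf, legendreSym.mul,
      show (4 : ℤ) = 2 ^ 2 by norm_num, legendreSym.sq_one' q (by
        rw [Int.cast_ofNat]; exact (two_ne_zero_zmod hq2)), one_mul]

/-- **`(d_K/q) = (D/q)`** for a quadratic field `K ∋ θ` with `θ² = D ∈ ℤ` NOT a square and an odd prime `q ∤ D`:
writing `D = d₀ f²` with `d₀` squarefree (`≠ 1`), `K = ℚ(√d₀)`, `d_K ∈ {d₀, 4d₀}` and both symbols are `(d₀/q)`.
[cite: Marcus2018, Ch. 2 Thm. 1] -/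
theorem legendreSym_discr_eq_of_sq_eq_intCast (h2 : finrank ℚ K = 2) {θ : K} {D : ℤ} (hsq : θ ^ 2 = (D : K))
    (hD : ¬ IsSquare D) {q : ℕ} [Fact q.Prime] (hq2 : q ≠ 2) (hqD : ¬ (q : ℤ) ∣ D) :
    legendreSym q (NumberField.discr K) = legendreSym q D := by
  have hD0 : D ≠ 0 := fun h => hD ⟨0, by rw [h, mul_zero]⟩
  obtain ⟨d₀, f, hsf, hf0, hDeq⟩ := exists_squarefree_mul_sq_eq hD0
  have hd1 : d₀ ≠ 1 := fun h => hD ⟨f, by rw [hDeq, h, one_mul, sq]⟩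
  have hf0K : (f : K) ≠ 0 := by exact_mod_cast hf0
  have hsq₀ : (θ / f) ^ 2 = (d₀ : K) := by
    rw [div_pow, hsq, hDeq]; push_cast; field_simp
  have hqf : ((f : ℤ) : ZMod q) ≠ 0 := by
    rw [Ne, ZMod.intCast_zmod_eq_zero_iff_dvd]
    intro hf; apply hqD; rw [hDeq, sq]; exact dvd_mul_of_dvd_right (dvd_mul_of_dvd_left hf f) d₀
  rw [legendreSym_discr_eq_of_sq_eq_squarefree h2 hsq₀ hsf hd1 hq2, hDeq, legendreSym.mul, legendreSym.sq_one' q hqf,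
    mul_one]

/-- **`(D/q) = 1` forces `q` NOT to be inert in a quadratic field containing `√D`** (`q` odd, `q ∤ D`, `D` not a
square): by the decomposition law `q` splits, so `q𝓞_K` is not prime. [cite: Marcus2018, Ch. 3 Thm. 25] -/
theorem not_isPrime_span_of_legendreSym_eq_one (h2 : finrank ℚ K = 2) {θ : K} {D : ℤ} (hsq : θ ^ 2 = (D : K))
    (hD : ¬ IsSquare D) {q : ℕ} [hq : Fact q.Prime] (hq2 : q ≠ 2) (hqD : ¬ (q : ℤ) ∣ D) (h1 : legendreSym q D = 1) :
    ¬ (span {((q : ℤ) : 𝓞 K)}).IsPrime :=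
  not_isPrime_span_of_ncard_primesOver_eq_two hq.out
    ((ncard_primesOver_eq_two_iff_legendreSym h2 hq2).mpr
      ((legendreSym_discr_eq_of_sq_eq_intCast h2 hsq hD hq2 hqD).trans h1))

/-! ### Inert ⟹ `(D/q) = -1` -/

/-- **`q` inert in `ℚ(√D)` implies `(D/q) = -1`** (`q` an odd prime, `q ∤ D`), for the tree's ideal-theoretic
predicate `CaiLiZhai2019.IsInertIn q D` ("`q𝓞_F` is prime in every quadratic `F ∋ √D`"). If `(D/q) = 1`, `q`
splits in `ℚ(√D)` (or, when `D` is a square, in `ℚ(√(1-q))`, which also contains `√D`), contradicting inertness.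
[cite: Marcus2018, Ch. 3 Thm. 25] [cite: ShuZhai2021, Def. 1.1] -/
theorem legendreSym_eq_neg_one_of_isInertIn {q : ℕ} [hq : Fact q.Prime] (hq2 : q ≠ 2) {D : ℤ}
    (hqD : ¬ (q : ℤ) ∣ D) (h : CaiLiZhai2019.IsInertIn q D) : legendreSym q D = -1 := by
  by_contra hne
  have hD0 : (D : ZMod q) ≠ 0 := by rwa [Ne, ZMod.intCast_zmod_eq_zero_iff_dvd]
  have h1 : legendreSym q D = 1 := (legendreSym.eq_one_or_neg_one q hD0).resolve_right hne
  by_cases hD : IsSquare D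
  · -- `D = m²`: use `F = ℚ(√(1 - q))`, where `q` splits (`1 - q ≡ 1 (mod q)`) and `√D = m ∈ F`
    obtain ⟨m, hm⟩ := hD
    have hns : ¬ IsSquare (1 - (q : ℤ)) := by
      rintro ⟨r, hr⟩
      have h0 : (0 : ℤ) ≤ 1 - q := by rw [hr, ← sq]; exact sq_nonneg r
      have := hq.out.two_le
      omega
    obtain ⟨F, _, _, hF2, θ, hθ⟩ := exists_numberField_sq_eq_of_not_isSquare hns
    have hprime := h F hF2 ⟨(m : F), by rw [hm, sq, Int.cast_mul]⟩
    have hq1 : ¬ (q : ℤ) ∣ 1 - q := by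
      intro hd
      have : (q : ℤ) ∣ 1 := by
        have := hd.add (dvd_refl (q : ℤ)); simpa using this
      exact hq.out.ne_one (by exact_mod_cast Int.eq_one_of_dvd_one (by positivity) this)
    have hleg : legendreSym q (1 - (q : ℤ)) = 1 := by
      rw [legendreSym.mod q (1 - (q : ℤ)), show (1 - (q : ℤ)) % q = 1 % q by simp,
        ← legendreSym.mod, legendreSym.at_one]
    exact not_isPrime_span_of_legendreSym_eq_one hF2 hθ hns hq2 hq1 hleg hprime
  · obtain ⟨F, _, _, hF2, θ, hθ⟩ := exists_numberField_sq_eq_of_not_isSquare hD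
    exact not_isPrime_span_of_legendreSym_eq_one hF2 hθ hD hq2 hqD h1 (h F hF2 ⟨θ, hθ⟩)

/-- The same for Shu–Zhai's rational form `IsInertInSqrt q (D : ℚ)` of the predicate.
[cite: ShuZhai2021, Def. 1.1] [cite: Marcus2018, Ch. 3 Thm. 25] -/
theorem legendreSym_eq_neg_one_of_isInertInSqrt_intCast {q : ℕ} [Fact q.Prime] (hq2 : q ≠ 2) {D : ℤ}
    (hqD : ¬ (q : ℤ) ∣ D) (h : ShuZhai2021.IsInertInSqrt q (D : ℚ)) : legendreSym q D = -1 :=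
  legendreSym_eq_neg_one_of_isInertIn hq2 hqD ((ShuZhai2021.isInertInSqrt_intCast q D).mp h)

/-! ### Every `ℓ ∣ n` split ⟹ `(D/ℓ) = 1` for odd `ℓ ∣ n`, and `D ≡ 1 (mod 8)` if `2 ∣ n` -/

/-- **The splitting hypothesis on Legendre symbols**: if `D` is squarefree and not a square, every prime `ℓ ∣ n`
splits in `ℚ(√D)` (`ShuZhai2021.AllPrimesSplitInSqrt n D`), and `ℓ ∣ n` is an odd prime, then `ℓ ∤ D` and
`(D/ℓ) = 1`. [cite: ShuZhai2021, §1 ("every prime `ℓ ∣ N` splits in `ℚ(√-p)`", Thm. 1.4 (ii))]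
[cite: Marcus2018, Ch. 3 Thm. 25] -/
theorem not_dvd_and_legendreSym_eq_one_of_allPrimesSplitInSqrt {n : ℕ} {D : ℤ} (h : ShuZhai2021.AllPrimesSplitInSqrt n D)
    (hD : ¬ IsSquare D) (hsf : Squarefree D) {ℓ : ℕ} [hℓ : Fact ℓ.Prime] (hℓ2 : ℓ ≠ 2) (hℓn : ℓ ∣ n) :
    ¬ (ℓ : ℤ) ∣ D ∧ legendreSym ℓ D = 1 := by
  rcases h with hsq | h
  · exact absurd hsq hD
  obtain ⟨F, _, _, hF2, θ, hθ⟩ := exists_numberField_sq_eq_of_not_isSquare hD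
  have hsplit := h F hF2 ⟨θ, hθ⟩ ℓ hℓ.out hℓn
  have hleg := (ncard_primesOver_eq_two_iff_legendreSym hF2 hℓ2).mp hsplit
  have hd1 : D ≠ 1 := fun h1 => hD ⟨1, by rw [h1, mul_one]⟩
  rw [legendreSym_discr_eq_of_sq_eq_squarefree hF2 hθ hsf hd1 hℓ2] at hleg
  refine ⟨fun hdvd => ?_, hleg⟩
  rw [(legendreSym.eq_zero_iff ℓ D).mpr ((ZMod.intCast_zmod_eq_zero_iff_dvd D ℓ).mpr hdvd)] at hleg
  exact zero_ne_one hleg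

/-- **The splitting hypothesis at `2`**: if `D` is squarefree and not a square, every prime `ℓ ∣ n` splits in
`ℚ(√D)`, and `2 ∣ n`, then `D ≡ 1 (mod 8)` (`2` splits iff `d_K ≡ 1 (mod 8)`, and `d_K = D` or `4D`).
[cite: ShuZhai2021, Thm. 1.4 (ii) ("every prime `ℓ ∣ 2N` splits")] [cite: Marcus2018, Ch. 3 Thm. 25] -/
theorem emod_eight_eq_one_of_allPrimesSplitInSqrt {n : ℕ} {D : ℤ} (h : ShuZhai2021.AllPrimesSplitInSqrt n D)
    (hD : ¬ IsSquare D) (hsf : Squarefree D) (h2n : 2 ∣ n) : D % 8 = 1 := by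
  rcases h with hsq | h
  · exact absurd hsq hD
  obtain ⟨F, _, _, hF2, θ, hθ⟩ := exists_numberField_sq_eq_of_not_isSquare hD
  have hsplit := h F hF2 ⟨θ, hθ⟩ 2 Nat.prime_two h2n
  simp only [Nat.cast_ofNat] at hsplit
  have h8 := (ncard_primesOver_two_eq_two_iff hF2).mp hsplit
  have hd1 : D ≠ 1 := fun h1 => hD ⟨1, by rw [h1, mul_one]⟩
  rcases emod_four_of_squarefree hsf with h1 | h23
  · rwa [discr_eq_of_sq_eq_intCast hF2 hθ h1 hsf hd1] at h8
  · rw [discr_eq_four_mul_of_sq_eq_intCast hF2 hθ h23 hsf] at h8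
    omega

end Literature.NumberTheory.QuadraticFields.Quadratic

end
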